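import Literature.Geometry.Lorentzian.SenParallelKIDTetrad
import HarnessLib

/-!
# The Pauli model of the spinor data: `ℂ² ≅ ℝ⁴` with `σ₁, σ₂, σ₃` and `J = i`

`SenParallelSpinorKID.lean` / `SenParallelKIDTetrad.lean` turn Sen–Witten-parallel spinor
fields into the translational Killing initial data of the rigid positive energy theorem
(Beig–Chruściel, J. Math. Phys. 37 (1996), Thm. 4.1 with App. A) for ABSTRACT Clifford data
(`σᵢ` symmetric on a real inner product space with `σᵢσⱼ + σⱼσᵢ = 2δᵢⱼ`). This file supplies
the concrete model and so shows those hypotheses consistent and physical: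

* `PauliModel.Spinor = ℝ⁴` (`≅ ℂ²`, coordinates `(Re u₁, Im u₁, Re u₂, Im u₂)`, real inner
  product `Re(u†w)`), `PauliModel.pauli i` — the Pauli operators `σ₁, σ₂, σ₃` in real form,
  `PauliModel.spinJ` — multiplication by `i`; proved: `pauli_symm` (Hermitian),
  `pauli_clifford` (Clifford relations), `spinJ_comm`, `spinJ_sq`, `spinJ_skew`;
* `PauliModel.stdCoeff`, `pairFst`, `pairSnd` — the four translational pairings
  `T₀ = ½(P(ψ₁,ψ₁) + P(ψ₂,ψ₂))`, `T₁ = P(ψ₁,ψ₂)`, `T₂ = P(ψ₁,Jψ₂)`,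
  `T₃ = ½(P(ψ₁,ψ₁) − P(ψ₂,ψ₂))` of a spinor pair (the Hermitian forms `ψ_A†σ^μψ_B`);
* `PauliModel.exists_kids_of_pauli_parallel_spinors` — **assembly**: on a connected data
  manifold with a smooth global orthonormal frame, two smooth Sen–Witten-parallel spinor
  fields with the standard values `(1,0)`, `(0,1)` at one point yield `(N_a, Y_a)_{a<4}`
  satisfying VERBATIM the six clauses of the analytic half `hA` of
  `positive_mass_rigidity_spacetime_of_kids_of_simplyConnected` (smooth, shift and lapse
  equations, Gram matrix `η`, `N₀ > 0`); `exists_kids_of_pauli_parallel_spinors_of_tendsto` —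
  the same for spinor fields TENDING to `(1,0)`, `(0,1)` along a nontrivial filter (at
  infinity), via `gram_stdBasis` (the Gram matrix of the standard basis is `η`, `N₀ = 1`).

So the analytic half of the rigidity theorem is reduced to: a global orthonormal frame of the
`3`-manifold, and Witten's existence theorem for Sen–Witten-parallel spinors asymptotic to a
constant orthonormal spinor frame when `E_ADM = 0` (Witten 1981, §3; Parker–Taubes 1982;
Beig–Chruściel 1996, App. A, (A.7)–(A.9)). Definitions are concrete (`def`s with bodies); no
named facts.

## References

* E. Witten, *A new proof of the positive energy theorem*, Comm. Math. Phys. 80 (1981)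
  381–402, §3. [Witten1981]
* R. Beig, P. T. Chruściel, *Killing vectors in asymptotically flat space-times. I*, J. Math.
  Phys. 37 (1996) 1939–1961, App. A, (A.7)–(A.11.0). [BeigChrusciel1996]
* T. Parker, C. H. Taubes, *On Witten's proof of the positive energy theorem*, Comm. Math.
  Phys. 84 (1982) 223–238, §2. [ParkerTaubes1982]
-/

noncomputable section

open Bundle Set Function Manifold Finset Filter
open scoped Manifold ContDiff Topology RealInnerProductSpace

namespace Literature.Geometry.Lorentzian

namespace PauliModel

/-! ### The operators -/

/-- The **real spinor space** `ℝ⁴ ≅ ℂ²` of a point of a `3`-manifold, in the coordinates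
`(Re u₁, Im u₁, Re u₂, Im u₂)` of `u = (u₁, u₂) ∈ ℂ²`, with the real inner product
`⟪u, w⟫ = Re(u†w)`. Witten 1981, §3; Beig–Chruściel 1996, App. A. [cite: Witten1981, §3] -/
abbrev Spinor : Type := EuclideanSpace ℝ (Fin 4)

/-- The **Pauli matrices in real form**, acting on coordinate vectors of `ℝ⁴ ≅ ℂ²`:
`σ₁(u₁, u₂) = (u₂, u₁)`, `σ₂(u₁, u₂) = (−iu₂, iu₁)`, `σ₃(u₁, u₂) = (u₁, −u₂)`. [folklore] -/
def pauliFun : Fin 3 → (Fin 4 → ℝ) → (Fin 4 → ℝ)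
  | 0, v => fun k ↦ match k with | 0 => v 2 | 1 => v 3 | 2 => v 0 | 3 => v 1
  | 1, v => fun k ↦ match k with | 0 => v 3 | 1 => -v 2 | 2 => -v 1 | 3 => v 0
  | 2, v => fun k ↦ match k with | 0 => v 0 | 1 => v 1 | 2 => -v 2 | 3 => -v 3

/-- **Multiplication by `i` in real form**: `(u₁, u₂) ↦ (iu₁, iu₂)`. [folklore] -/
def spinJFun (v : Fin 4 → ℝ) : Fin 4 → ℝ :=
  fun k ↦ match k with | 0 => -v 1 | 1 => v 0 | 2 => -v 3 | 3 => v 2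

/-- The Pauli operators as linear endomorphisms of the real spinor space. [folklore] -/
def pauliLin (i : Fin 3) : Spinor →ₗ[ℝ] Spinor where
  toFun x := WithLp.toLp 2 (pauliFun i (WithLp.ofLp x))
  map_add' x y := by
    ext k
    fin_cases i <;> fin_cases k <;> simp [pauliFun] <;> ring
  map_smul' c x := by
    ext k
    fin_cases i <;> fin_cases k <;> simp [pauliFun]

/-- Multiplication by `i` as a linear endomorphism of the real spinor space. [folklore] -/
def spinJLin : Spinor →ₗ[ℝ] Spinor where
  toFun x := WithLp.toLp 2 (spinJFun (WithLp.ofLp x))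
  map_add' x y := by
    ext k
    fin_cases k <;> simp [spinJFun] <;> ring
  map_smul' c x := by
    ext k
    fin_cases k <;> simp [spinJFun]

/-- The **Pauli operators** `σ₁, σ₂, σ₃` on the real spinor space `ℝ⁴ ≅ ℂ²` (continuous
linear maps). Witten 1981, §3 (`γ`-matrices of the hypersurface Dirac operator).
[cite: Witten1981, §3] -/
def pauli (i : Fin 3) : Spinor →L[ℝ] Spinor :=
  LinearMap.toContinuousLinearMap (pauliLin i)

/-- The **complex structure** `J` (multiplication by `i`) on the real spinor space. [folklore] -/
def spinJ : Spinor →L[ℝ] Spinor :=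
  LinearMap.toContinuousLinearMap spinJLin

/-- Components of `σᵢ u`. [folklore] -/
@[simp] theorem pauli_apply (i : Fin 3) (x : Spinor) (k : Fin 4) :
    pauli i x k = pauliFun i (WithLp.ofLp x) k := rfl

/-- Components of `J u`. [folklore] -/
@[simp] theorem spinJ_apply (x : Spinor) (k : Fin 4) :
    spinJ x k = spinJFun (WithLp.ofLp x) k := rfl

/-- **The Pauli operators are symmetric** for `⟪u, w⟫ = Re(u†w)` (they are Hermitian).
[folklore] -/
theorem pauli_symm (i : Fin 3) (a b : Spinor) : ⟪pauli i a, b⟫ = ⟪a, pauli i b⟫ := by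
  fin_cases i <;> simp [PiLp.inner_apply, Fin.sum_univ_four, pauliFun] <;> ring

/-- **The Clifford relations** `σᵢσⱼ + σⱼσᵢ = 2δᵢⱼ`. [folklore] -/
theorem pauli_clifford (i j : Fin 3) (a : Spinor) :
    pauli i (pauli j a) + pauli j (pauli i a) = if i = j then (2 : ℝ) • a else 0 := by
  ext k
  fin_cases i <;> fin_cases j <;> fin_cases k <;> simp [pauliFun] <;> ring

/-- `J` commutes with the Pauli operators (they are complex-linear). [folklore] -/
theorem spinJ_comm (i : Fin 3) (a : Spinor) : spinJ (pauli i a) = pauli i (spinJ a) := by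
  ext k
  fin_cases i <;> fin_cases k <;> simp [pauliFun, spinJFun]

/-- `J² = −1`. [folklore] -/
theorem spinJ_sq (a : Spinor) : spinJ (spinJ a) = -a := by
  ext k
  fin_cases k <;> simp [spinJFun]

/-- `J` is skew for the real inner product. [folklore] -/
theorem spinJ_skew (a b : Spinor) : ⟪spinJ a, b⟫ = -⟪a, spinJ b⟫ := by
  simp [PiLp.inner_apply, Fin.sum_univ_four, spinJFun]
  ring

/-! ### The four translational pairings of a spinor pair -/

/-- **The coefficients of the four translational KIDs** in terms of the pairings
`P₀ = (ψ₁, ψ₁)`, `P₁ = (ψ₂, ψ₂)`, `P₂ = (ψ₁, ψ₂)`, `P₃ = (ψ₁, Jψ₂)` of a spinor pair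
`(ψ₁, ψ₂)`: `T₀ = ½(P₀ + P₁)`, `T₁ = P₂`, `T₂ = P₃`, `T₃ = ½(P₀ − P₁)` — the Hermitian forms
`½ψ†ψ`, `Re ψ₁†σψ₂`, … realising `ψ_A†σ^μψ_B` (Beig–Chruściel 1996, (A.11.0); Witten 1981, §3).
[cite: BeigChrusciel1996, App. A, (A.11.0)] -/
def stdCoeff : Fin 4 → Fin 4 → ℝ
  | 0 => fun r ↦ match r with | 0 => 1 / 2 | 1 => 1 / 2 | 2 => 0 | 3 => 0
  | 1 => fun r ↦ match r with | 0 => 0 | 1 => 0 | 2 => 1 | 3 => 0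
  | 2 => fun r ↦ match r with | 0 => 0 | 1 => 0 | 2 => 0 | 3 => 1
  | 3 => fun r ↦ match r with | 0 => 1 / 2 | 1 => -1 / 2 | 2 => 0 | 3 => 0

/-- First members `(ψ₁, ψ₂, ψ₁, ψ₁)` of the four pairings of a spinor pair. [folklore] -/
def pairFst {X : Type*} (ψ₁ ψ₂ : X → Spinor) : Fin 4 → X → Spinor
  | 0 => ψ₁
  | 1 => ψ₂
  | 2 => ψ₁
  | 3 => ψ₁

/-- Second members `(ψ₁, ψ₂, ψ₂, Jψ₂)` of the four pairings of a spinor pair. [folklore] -/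
def pairSnd {X : Type*} (ψ₁ ψ₂ : X → Spinor) : Fin 4 → X → Spinor
  | 0 => ψ₁
  | 1 => ψ₂
  | 2 => ψ₂
  | 3 => fun x ↦ spinJ (ψ₂ x)

/-! ### Assembly on a data manifold -/

section Assembly

variable {X : Type*} [TopologicalSpace X] [ChartedSpace E3 X] [IsManifold (𝓡 3) ∞ X]
  (D : InitialDataSet (𝓡 3) X) [D.metric.HasLeviCivita]

omit [D.metric.HasLeviCivita] in
/-- Pairing of frame expansions in an orthonormal frame: `h(Σ yᵢFᵢ, Σ zᵢFᵢ) = Σ yᵢzᵢ`.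
[folklore] -/
theorem inner_frameSum {F : Fin 3 → Π x : X, TangentSpace (𝓡 3) x} {x : X}
    (horth : ∀ i j, D.h.inner x (F i x) (F j x) = if i = j then 1 else 0) (y z : Fin 3 → ℝ) :
    D.h.inner x (∑ i, y i • F i x) (∑ i, z i • F i x) = ∑ i, y i * z i := by
  simp only [map_sum, map_smul, _root_.sum_apply, smul_apply, smul_eq_mul, horth, mul_ite,
    mul_one, mul_zero, Finset.sum_ite_eq', Finset.mem_univ, if_true]
  exact Finset.sum_congr rfl fun i _ ↦ mul_comm _ _

/-- **The analytic half of the rigidity theorem, reduced to Witten's spinors (Pauli model).**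
On a connected data manifold `(X, h, k)` with a smooth global `h`-orthonormal frame `(Fᵢ)`
(connection coefficients `ω_{ij}(v) = h(∇ᵥFᵢ, Fⱼ)`), let `ψ₁, ψ₂ : X → ℝ⁴ ≅ ℂ²` be smooth
spinor fields, parallel for the Sen–Witten connection
`dψ(v) = ¼ Σ ω_{ij}(v) σᵢσⱼψ − ½ Σ k(v, Fᵢ) σᵢψ`, taking at one point `x₀` the values of the
standard spinor basis `ψ₁(x₀) = (1, 0)`, `ψ₂(x₀) = (0, 1)`. Then the four translational pairings
`T₀ = ½(P(ψ₁,ψ₁) + P(ψ₂,ψ₂))`, `T₁ = P(ψ₁,ψ₂)`, `T₂ = P(ψ₁,Jψ₂)`, `T₃ = ½(P(ψ₁,ψ₁) − P(ψ₂,ψ₂))`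
(`P(ψ, φ) = (⟪ψ, φ⟫, Σ⟪ψ, σᵢφ⟫Fᵢ)`) are smooth translational KIDs `(N_a, Y_a)` with Gram matrix
`η` and `N₀ > 0` — verbatim the output of the analytic half `hA` of
`positive_mass_rigidity_spacetime_of_kids_of_simplyConnected`. (At `x₀`:
`N = (1, 0, 0, 0)`, `Y_aⁱ = δ_{ai}`.) What `hA` still requires is the EXISTENCE of such
`ψ₁, ψ₂` under `E_ADM = 0` and the dominant energy condition — Witten's theorem (Witten 1981,
§3; Parker–Taubes 1982; Beig–Chruściel 1996, App. A, (A.7)–(A.9)) — and a global orthonormal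
frame. [cite: BeigChrusciel1996, App. A, (A.7)–(A.11.0)] -/
theorem exists_kids_of_pauli_parallel_spinors [ConnectedSpace X]
    {F : Fin 3 → Π x : X, TangentSpace (𝓡 3) x}
    (hF : ∀ i, ContMDiff (𝓡 3) ((𝓡 3).prod 𝓘(ℝ, E3)) ∞
      fun y ↦ (TotalSpace.mk' E3 y (F i y) : TangentBundle (𝓡 3) X))
    (horth : ∀ x i j, D.h.inner x (F i x) (F j x) = if i = j then 1 else 0)
    (Ω : Fin 3 → Fin 3 → Π x : X, TangentSpace (𝓡 3) x → ℝ)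
    (hω : ∀ i j x v, Ω i j x v = D.metric.val x (D.metric.leviCivita (F i) x v) (F j x))
    {ψ₁ ψ₂ : X → Spinor} (h1s : ContMDiff (𝓡 3) 𝓘(ℝ, Spinor) ∞ ψ₁)
    (h2s : ContMDiff (𝓡 3) 𝓘(ℝ, Spinor) ∞ ψ₂)
    (h1 : ∀ (x : X) (v : TangentSpace (𝓡 3) x), mvfderiv (𝓡 3) ψ₁ x v =
      (1 / 4 : ℝ) • (∑ i, ∑ j, Ω i j x v • pauli i (pauli j (ψ₁ x))) -
        (1 / 2 : ℝ) • ∑ i, D.k x v (F i x) • pauli i (ψ₁ x))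
    (h2 : ∀ (x : X) (v : TangentSpace (𝓡 3) x), mvfderiv (𝓡 3) ψ₂ x v =
      (1 / 4 : ℝ) • (∑ i, ∑ j, Ω i j x v • pauli i (pauli j (ψ₂ x))) -
        (1 / 2 : ℝ) • ∑ i, D.k x v (F i x) • pauli i (ψ₂ x))
    {x₀ : X} (hx₁ : ψ₁ x₀ = EuclideanSpace.single 0 1) (hx₂ : ψ₂ x₀ = EuclideanSpace.single 2 1) :
    ∃ (N : Fin 4 → X → ℝ) (Y : Fin 4 → Π x : X, TangentSpace (𝓡 3) x),
      (∀ a, ContMDiff (𝓡 3) 𝓘(ℝ, ℝ) ∞ (N a)) ∧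
      (∀ a, ContMDiff (𝓡 3) ((𝓡 3).prod (𝓡 3)) ∞
        fun x ↦ (TotalSpace.mk' E3 x (Y a x) : TangentBundle (𝓡 3) X)) ∧
      (∀ a (x : X) (v w : TangentSpace (𝓡 3) x),
        D.metric.val x (D.metric.leviCivita (Y a) x v) w = -(N a x * D.k x v w)) ∧
      (∀ a (x : X) (v : TangentSpace (𝓡 3) x),
        mvfderiv (𝓡 3) (N a) x v = -(D.k x v (Y a x))) ∧
      (∀ (x : X) a b, -(N a x * N b x) + D.h.inner x (Y a x) (Y b x) =
        if a = b then (if a = 0 then -1 else 1) else 0) ∧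
      ∀ x, 0 < N 0 x := by
  have h2d : MDifferentiable (𝓡 3) 𝓘(ℝ, Spinor) ψ₂ := fun x ↦ (h2s x).mdifferentiableAt (by simp)
  -- the four pairs and their regularity / parallelism
  have hαs : ∀ r, ContMDiff (𝓡 3) 𝓘(ℝ, Spinor) ∞ (pairFst ψ₁ ψ₂ r) := fun r ↦ by
    match r with
    | 0 => exact h1s
    | 1 => exact h2s
    | 2 => exact h1s
    | 3 => exact h1s
  have hβs : ∀ r, ContMDiff (𝓡 3) 𝓘(ℝ, Spinor) ∞ (pairSnd ψ₁ ψ₂ r) := fun r ↦ by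
    match r with
    | 0 => exact h1s
    | 1 => exact h2s
    | 2 => exact h2s
    | 3 => exact SenParallel.contMDiff_clm_apply_comp spinJ h2s
  have hα : ∀ r (x : X) (v : TangentSpace (𝓡 3) x), mvfderiv (𝓡 3) (pairFst ψ₁ ψ₂ r) x v =
      (1 / 4 : ℝ) • (∑ i, ∑ j, Ω i j x v • pauli i (pauli j (pairFst ψ₁ ψ₂ r x))) -
        (1 / 2 : ℝ) • ∑ i, D.k x v (F i x) • pauli i (pairFst ψ₁ ψ₂ r x) := fun r ↦ by
    match r with
    | 0 => exact h1
    | 1 => exact h2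
    | 2 => exact h1
    | 3 => exact h1
  have hβ : ∀ r (x : X) (v : TangentSpace (𝓡 3) x), mvfderiv (𝓡 3) (pairSnd ψ₁ ψ₂ r) x v =
      (1 / 4 : ℝ) • (∑ i, ∑ j, Ω i j x v • pauli i (pauli j (pairSnd ψ₁ ψ₂ r x))) -
        (1 / 2 : ℝ) • ∑ i, D.k x v (F i x) • pauli i (pairSnd ψ₁ ψ₂ r x) := fun r ↦ by
    match r with
    | 0 => exact h1
    | 1 => exact h2
    | 2 => exact h2
    | 3 => exact SenParallel.parallel_clm_comp D pauli spinJ spinJ_comm Ω h2d h2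
  -- the KIDs
  set N : Fin 4 → X → ℝ := fun a x ↦ ∑ r, stdCoeff a r * ⟪pairFst ψ₁ ψ₂ r x, pairSnd ψ₁ ψ₂ r x⟫
    with hN
  set Y : Fin 4 → Π x : X, TangentSpace (𝓡 3) x := fun a x ↦
    ∑ i, (∑ r, stdCoeff a r * ⟪pairFst ψ₁ ψ₂ r x, pauli i (pairSnd ψ₁ ψ₂ r x)⟫) • F i x with hY
  -- values at `x₀`
  have hx₀ : ∀ a b, (-(N a x₀ * N b x₀) + D.h.inner x₀ (Y a x₀) (Y b x₀) =
      if a = b then (if a = 0 then -1 else 1) else 0) ∧ N 0 x₀ = 1 := by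
    intro a b
    simp only [hN, hY]
    have e1 : ∀ r, pairFst ψ₁ ψ₂ r x₀ = match r with
        | 0 => EuclideanSpace.single 0 1 | 1 => EuclideanSpace.single 2 1
        | 2 => EuclideanSpace.single 0 1 | 3 => EuclideanSpace.single 0 1 := fun r ↦ by
      match r with
      | 0 => exact hx₁
      | 1 => exact hx₂
      | 2 => exact hx₁
      | 3 => exact hx₁
    have e2 : ∀ r, pairSnd ψ₁ ψ₂ r x₀ = match r with
        | 0 => EuclideanSpace.single 0 1 | 1 => EuclideanSpace.single 2 1
        | 2 => EuclideanSpace.single 2 1 | 3 => spinJ (EuclideanSpace.single 2 1) := fun r ↦ by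
      match r with
      | 0 => exact hx₁
      | 1 => exact hx₂
      | 2 => exact hx₂
      | 3 => exact congrArg spinJ hx₂
    simp only [Fin.sum_univ_four, Fin.sum_univ_three, e1, e2]
    fin_cases a <;> fin_cases b <;>
      simp [horth, stdCoeff, PiLp.inner_apply, pauliFun, spinJFun] <;> norm_num
  obtain ⟨h1', h2', h3', h4', h5', h6'⟩ := SenParallel.exists_kids_of_parallel_spinors D pauli
    pauli_symm pauli_clifford hF horth Ω hω Finset.univ stdCoeff hαs hβs hα hβ N
    (fun _ _ ↦ rfl) Y (fun _ _ ↦ rfl) (fun a b ↦ (hx₀ a b).1) (by rw [(hx₀ 0 0).2]; exact one_pos)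
  exact ⟨N, Y, h1', h2', h3', h4', h5', h6'⟩

/-! ### The asymptotic form: spinors tending to the standard basis along a filter -/

/-- Point values of the first members of the four pairings. [folklore] -/
def pairFstPt (u w : Spinor) : Fin 4 → Spinor
  | 0 => u
  | 1 => w
  | 2 => u
  | 3 => u

/-- Point values of the second members of the four pairings. [folklore] -/
def pairSndPt (u w : Spinor) : Fin 4 → Spinor
  | 0 => u
  | 1 => w
  | 2 => w
  | 3 => spinJ w

omit [TopologicalSpace X] [ChartedSpace E3 X] [IsManifold (𝓡 3) ∞ X] [D.metric.HasLeviCivita] in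
/-- `pairFst` is `pairFstPt` of the point values. [folklore] -/
theorem pairFst_apply (ψ₁ ψ₂ : X → Spinor) (r : Fin 4) (x : X) :
    pairFst ψ₁ ψ₂ r x = pairFstPt (ψ₁ x) (ψ₂ x) r := by
  match r with
  | 0 => rfl
  | 1 => rfl
  | 2 => rfl
  | 3 => rfl

omit [TopologicalSpace X] [ChartedSpace E3 X] [IsManifold (𝓡 3) ∞ X] [D.metric.HasLeviCivita] in
/-- `pairSnd` is `pairSndPt` of the point values. [folklore] -/
theorem pairSnd_apply (ψ₁ ψ₂ : X → Spinor) (r : Fin 4) (x : X) :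
    pairSnd ψ₁ ψ₂ r x = pairSndPt (ψ₁ x) (ψ₂ x) r := by
  match r with
  | 0 => rfl
  | 1 => rfl
  | 2 => rfl
  | 3 => rfl

/-- The point values of the pairings depend continuously on the spinor pair. [folklore] -/
theorem continuous_pairFstPt (r : Fin 4) :
    Continuous fun p : Spinor × Spinor ↦ pairFstPt p.1 p.2 r := by
  match r with
  | 0 => exact continuous_fst
  | 1 => exact continuous_snd
  | 2 => exact continuous_fst
  | 3 => exact continuous_fst

/-- The point values of the pairings depend continuously on the spinor pair. [folklore] -/
theorem continuous_pairSndPt (r : Fin 4) :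
    Continuous fun p : Spinor × Spinor ↦ pairSndPt p.1 p.2 r := by
  match r with
  | 0 => exact continuous_fst
  | 1 => exact continuous_snd
  | 2 => exact continuous_snd
  | 3 => exact spinJ.continuous.comp continuous_snd

/-- **The Gram matrix of the four pairings at the standard basis is `η`, and `N₀ = 1`**
(the values at infinity of Witten's spinors): for `u = (1, 0)`, `w = (0, 1)`,
`−N_aN_b + Σᵢ Y_aⁱY_bⁱ = η_{ab}` where `N_a = Σ_r c_{ar}⟪fst_r, snd_r⟫`,
`Y_aⁱ = Σ_r c_{ar}⟪fst_r, σᵢ snd_r⟫`. [cite: Witten1981, §3] -/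
theorem gram_stdBasis (a b : Fin 4) :
    (∑ r, stdCoeff 0 r * ⟪pairFstPt (EuclideanSpace.single 0 1) (EuclideanSpace.single 2 1) r,
        pairSndPt (EuclideanSpace.single 0 1) (EuclideanSpace.single 2 1) r⟫) = 1 ∧
    -((∑ r, stdCoeff a r * ⟪pairFstPt (EuclideanSpace.single 0 1) (EuclideanSpace.single 2 1) r,
        pairSndPt (EuclideanSpace.single 0 1) (EuclideanSpace.single 2 1) r⟫) *
      (∑ r, stdCoeff b r * ⟪pairFstPt (EuclideanSpace.single 0 1) (EuclideanSpace.single 2 1) r,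
        pairSndPt (EuclideanSpace.single 0 1) (EuclideanSpace.single 2 1) r⟫)) +
      ∑ i, (∑ r, stdCoeff a r *
          ⟪pairFstPt (EuclideanSpace.single 0 1) (EuclideanSpace.single 2 1) r,
            pauli i (pairSndPt (EuclideanSpace.single 0 1) (EuclideanSpace.single 2 1) r)⟫) *
        (∑ r, stdCoeff b r *
          ⟪pairFstPt (EuclideanSpace.single 0 1) (EuclideanSpace.single 2 1) r,
            pauli i (pairSndPt (EuclideanSpace.single 0 1) (EuclideanSpace.single 2 1) r)⟫) =
      (if a = b then (if a = 0 then -1 else 1) else 0) := by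
  simp only [Fin.sum_univ_four, Fin.sum_univ_three, pairFstPt, pairSndPt]
  fin_cases a <;> fin_cases b <;>
    simp [stdCoeff, PiLp.inner_apply, pauliFun, spinJFun] <;> norm_num

/-- **The analytic half from spinors ASYMPTOTIC to the standard basis** (the form in which
Witten's theorem delivers them: `ψ_A → ψ_A^∞` at infinity along the asymptotically flat end,
Witten 1981, §3; Parker–Taubes 1982, Thm. 4.3; Beig–Chruściel 1996, (A.8)–(A.9)). Same setting
as `exists_kids_of_pauli_parallel_spinors`, but instead of prescribing the values at a point we
assume `ψ₁ → (1, 0)`, `ψ₂ → (0, 1)` along some nontrivial filter `l` on `X` (e.g. the filter at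
infinity of the end). Since the Gram matrix of the KIDs is constant
(`kidPairing_eq_of_connectedSpace`) and the pairings are continuous in the spinors, it equals
its limit `η` (`gram_stdBasis`), and
`N₀ → 1` gives a point with `N₀ > 0`. [cite: BeigChrusciel1996, App. A, (A.7)–(A.11.0)] -/
theorem exists_kids_of_pauli_parallel_spinors_of_tendsto [ConnectedSpace X]
    {F : Fin 3 → Π x : X, TangentSpace (𝓡 3) x}
    (hF : ∀ i, ContMDiff (𝓡 3) ((𝓡 3).prod 𝓘(ℝ, E3)) ∞
      fun y ↦ (TotalSpace.mk' E3 y (F i y) : TangentBundle (𝓡 3) X))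
    (horth : ∀ x i j, D.h.inner x (F i x) (F j x) = if i = j then 1 else 0)
    (Ω : Fin 3 → Fin 3 → Π x : X, TangentSpace (𝓡 3) x → ℝ)
    (hω : ∀ i j x v, Ω i j x v = D.metric.val x (D.metric.leviCivita (F i) x v) (F j x))
    {ψ₁ ψ₂ : X → Spinor} (h1s : ContMDiff (𝓡 3) 𝓘(ℝ, Spinor) ∞ ψ₁)
    (h2s : ContMDiff (𝓡 3) 𝓘(ℝ, Spinor) ∞ ψ₂)
    (h1 : ∀ (x : X) (v : TangentSpace (𝓡 3) x), mvfderiv (𝓡 3) ψ₁ x v =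
      (1 / 4 : ℝ) • (∑ i, ∑ j, Ω i j x v • pauli i (pauli j (ψ₁ x))) -
        (1 / 2 : ℝ) • ∑ i, D.k x v (F i x) • pauli i (ψ₁ x))
    (h2 : ∀ (x : X) (v : TangentSpace (𝓡 3) x), mvfderiv (𝓡 3) ψ₂ x v =
      (1 / 4 : ℝ) • (∑ i, ∑ j, Ω i j x v • pauli i (pauli j (ψ₂ x))) -
        (1 / 2 : ℝ) • ∑ i, D.k x v (F i x) • pauli i (ψ₂ x))
    {l : Filter X} [l.NeBot] (hl₁ : Tendsto ψ₁ l (𝓝 (EuclideanSpace.single 0 1)))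
    (hl₂ : Tendsto ψ₂ l (𝓝 (EuclideanSpace.single 2 1))) :
    ∃ (N : Fin 4 → X → ℝ) (Y : Fin 4 → Π x : X, TangentSpace (𝓡 3) x),
      (∀ a, ContMDiff (𝓡 3) 𝓘(ℝ, ℝ) ∞ (N a)) ∧
      (∀ a, ContMDiff (𝓡 3) ((𝓡 3).prod (𝓡 3)) ∞
        fun x ↦ (TotalSpace.mk' E3 x (Y a x) : TangentBundle (𝓡 3) X)) ∧
      (∀ a (x : X) (v w : TangentSpace (𝓡 3) x),
        D.metric.val x (D.metric.leviCivita (Y a) x v) w = -(N a x * D.k x v w)) ∧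
      (∀ a (x : X) (v : TangentSpace (𝓡 3) x),
        mvfderiv (𝓡 3) (N a) x v = -(D.k x v (Y a x))) ∧
      (∀ (x : X) a b, -(N a x * N b x) + D.h.inner x (Y a x) (Y b x) =
        if a = b then (if a = 0 then -1 else 1) else 0) ∧
      ∀ x, 0 < N 0 x := by
  have h2d : MDifferentiable (𝓡 3) 𝓘(ℝ, Spinor) ψ₂ := fun x ↦ (h2s x).mdifferentiableAt (by simp)
  -- the four pairs and their regularity / parallelism
  have hαs : ∀ r, ContMDiff (𝓡 3) 𝓘(ℝ, Spinor) ∞ (pairFst ψ₁ ψ₂ r) := fun r ↦ by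
    match r with
    | 0 => exact h1s
    | 1 => exact h2s
    | 2 => exact h1s
    | 3 => exact h1s
  have hβs : ∀ r, ContMDiff (𝓡 3) 𝓘(ℝ, Spinor) ∞ (pairSnd ψ₁ ψ₂ r) := fun r ↦ by
    match r with
    | 0 => exact h1s
    | 1 => exact h2s
    | 2 => exact h2s
    | 3 => exact SenParallel.contMDiff_clm_apply_comp spinJ h2s
  have hα : ∀ r (x : X) (v : TangentSpace (𝓡 3) x), mvfderiv (𝓡 3) (pairFst ψ₁ ψ₂ r) x v =
      (1 / 4 : ℝ) • (∑ i, ∑ j, Ω i j x v • pauli i (pauli j (pairFst ψ₁ ψ₂ r x))) -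
        (1 / 2 : ℝ) • ∑ i, D.k x v (F i x) • pauli i (pairFst ψ₁ ψ₂ r x) := fun r ↦ by
    match r with
    | 0 => exact h1
    | 1 => exact h2
    | 2 => exact h1
    | 3 => exact h1
  have hβ : ∀ r (x : X) (v : TangentSpace (𝓡 3) x), mvfderiv (𝓡 3) (pairSnd ψ₁ ψ₂ r) x v =
      (1 / 4 : ℝ) • (∑ i, ∑ j, Ω i j x v • pauli i (pauli j (pairSnd ψ₁ ψ₂ r x))) -
        (1 / 2 : ℝ) • ∑ i, D.k x v (F i x) • pauli i (pairSnd ψ₁ ψ₂ r x) := fun r ↦ by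
    match r with
    | 0 => exact h1
    | 1 => exact h2
    | 2 => exact h2
    | 3 => exact SenParallel.parallel_clm_comp D pauli spinJ spinJ_comm Ω h2d h2
  -- the KIDs
  set N : Fin 4 → X → ℝ := fun a x ↦ ∑ r, stdCoeff a r * ⟪pairFst ψ₁ ψ₂ r x, pairSnd ψ₁ ψ₂ r x⟫
    with hN
  set Y : Fin 4 → Π x : X, TangentSpace (𝓡 3) x := fun a x ↦
    ∑ i, (∑ r, stdCoeff a r * ⟪pairFst ψ₁ ψ₂ r x, pauli i (pairSnd ψ₁ ψ₂ r x)⟫) • F i x with hY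
  -- continuity of the pairings in the spinor values, as functions on `X`
  set Npt : Fin 4 → Spinor × Spinor → ℝ := fun a p ↦
    ∑ r, stdCoeff a r * ⟪pairFstPt p.1 p.2 r, pairSndPt p.1 p.2 r⟫ with hNpt
  set Ypt : Fin 4 → Fin 3 → Spinor × Spinor → ℝ := fun a i p ↦
    ∑ r, stdCoeff a r * ⟪pairFstPt p.1 p.2 r, pauli i (pairSndPt p.1 p.2 r)⟫ with hYpt
  have hNc : ∀ a, Continuous (Npt a) := fun a ↦
    continuous_finsetSum _ fun r _ ↦ continuous_const.mul
      ((continuous_pairFstPt r).inner (continuous_pairSndPt r))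
  have hYc : ∀ a i, Continuous (Ypt a i) := fun a i ↦
    continuous_finsetSum _ fun r _ ↦ continuous_const.mul
      ((continuous_pairFstPt r).inner ((pauli i).continuous.comp (continuous_pairSndPt r)))
  have hNx : ∀ a x, N a x = Npt a (ψ₁ x, ψ₂ x) := fun a x ↦ by
    simp only [hN, hNpt, pairFst_apply, pairSnd_apply]
  have hGx : ∀ a b x, -(N a x * N b x) + D.h.inner x (Y a x) (Y b x) =
      -(Npt a (ψ₁ x, ψ₂ x) * Npt b (ψ₁ x, ψ₂ x)) +
        ∑ i, Ypt a i (ψ₁ x, ψ₂ x) * Ypt b i (ψ₁ x, ψ₂ x) := fun a b x ↦ by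
    rw [hNx, hNx, hY, inner_frameSum D (horth x)]
    simp only [hYpt, pairFst_apply, pairSnd_apply]
  have hpair : Tendsto (fun x ↦ (ψ₁ x, ψ₂ x)) l
      (𝓝 ((EuclideanSpace.single 0 1 : Spinor), (EuclideanSpace.single 2 1 : Spinor))) :=
    hl₁.prodMk_nhds hl₂
  -- limits along `l`
  have hGlim : ∀ a b, Tendsto (fun x ↦ -(N a x * N b x) + D.h.inner x (Y a x) (Y b x)) l
      (𝓝 (if a = b then (if a = 0 then -1 else 1) else 0)) := by
    intro a b
    have hc : Continuous fun p : Spinor × Spinor ↦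
        -(Npt a p * Npt b p) + ∑ i, Ypt a i p * Ypt b i p :=
      ((hNc a).mul (hNc b)).neg.add (continuous_finsetSum _ fun i _ ↦ (hYc a i).mul (hYc b i))
    have hlim := (hc.tendsto _).comp hpair
    rw [← (gram_stdBasis a b).2]
    refine hlim.congr fun x ↦ ?_
    simp only [Function.comp_apply, hGx]
  have hN₀ : Tendsto (N 0) l (𝓝 1) := by
    have hlim := ((hNc 0).tendsto _).comp hpair
    rw [← (gram_stdBasis 0 0).1]
    refine hlim.congr fun x ↦ ?_
    simp only [Function.comp_apply, hNx]
  obtain ⟨h1', h2', h3', h4', h5', h6'⟩ :=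
    SenParallel.exists_kids_of_parallel_spinors_of_tendsto D pauli pauli_symm pauli_clifford hF
      horth Ω hω Finset.univ stdCoeff hαs hβs hα hβ N (fun _ _ ↦ rfl) Y (fun _ _ ↦ rfl) hGlim
      one_pos hN₀
  exact ⟨N, Y, h1', h2', h3', h4', h5', h6'⟩

end Assembly

end PauliModel

end Literature.Geometry.Lorentzian

end
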